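import Summits.Ventures.CertifiedArithmetic.Expansions.Orient3dStageCModel
import Mathlib.Tactic.Linarith
import Mathlib.Tactic.Positivity
import Mathlib.Tactic.Ring
import Mathlib.Tactic.NormNum

/-!
# ORIENT3D, stage C of `orient3dadapt` in the floating-point model: the returned sign is correct

NEW WORK in the sense of this development (the algorithm is Shewchuk's `orient3dadapt`, file
`predicates.c`; the model over `ℚ`, the constants' certification, statements and proofs are ours;
nothing here is cited anywhere as a literature fact).  The model `orient3dStageC`, its grids and
the early exit are `Orient3dStageCModel.lean`.

THE RESULT (`orient3dStageC_correct_of_estimate_of_margin`) — GENERIC in the two quantities the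
literature argues about: the relative error bound `δ` of `estimate` on W-expansions of floats
(hypothesis `hest`: `|estimate(e) − Σe| ≤ δ|Σe|`) and the coefficient `K_R` of `|det|` in the error
bound (any `K_R ∈ 2^(−2p) ℤ` satisfying the margin (MR) `δ < (1 − δ)(1 − ε)³ K_R`, hypothesis
`hmarginR`).  Let `p ≥ 4`, `fl` any round-to-nearest into `F(p, emin)` with the `RoundoffBelow 2`
property, the coordinates floats of `F(p, e₀)` with `emin ≤ e₀` and `emin + 3p ≤ 3e₀`, and `tp`
error-free on the formats used.  If stage C, run with `K_C = (26 + 288ε)ε² = o3derrboundC p`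
(Shewchuk's constant), `K_R` and the permanent of stage A, returns `d`, then `d > 0 ↔ (7) > 0` and
`d < 0 ↔ (7) < 0` for the EXACT determinant `orient3dDet`; in particular `d ≠ 0`.
INSTANCES: the lane's `δ = 3ε`, `K_R = o3dresulterrbound24 p = (3 + 24ε)ε` (here,
`orient3dStageC_correct_of_estimate`); Shewchuk's PRINTED `K_R = resulterrbound p = (3 + 8ε)ε`
with the proved sharp `δ = (5/2)ε`, `p ≥ 5`, in `Orient3dStageCCorrect.lean` (`…_correct_printed`).

HOW.  Pure plumbing onto the real-number core `orient3d_stageC_sign_of_bounds`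
(`Orient3dStageCBounds`): every one of its ~70 hypotheses is a standard-model bound
`|x ∘ y − fl(x ∘ y)| ≤ ε|x ∘ y|` or `≤ ε|fl(x ∘ y)|` of this library (`abs_sub_fl_le_eps_mul_abs`,
`abs_sub_fl_le_eps_mul_abs_fl`), valid because every intermediate quantity lies on a grid `2^s ℤ`
with `s ≥ emin`: the differences and tails on `2^e₀ ℤ`, products on `2^2e₀ ℤ`, the correction
terms, the permanent `W` and — by `ExpansionGrids` — `det = estimate(fin1)` on `2^3e₀ ℤ`, the error
bound on `2^(3e₀ − 3p) ℤ`; the margin `o3derrboundC_margin` and the hypothesis `hmarginR`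
(`p ≥ 4`), and `|det − B| ≤ δ|B|` is `hest` on the W-expansion `fin1` (`orient3dB_spec`).

HONEST CAVEATS.  (1) `hest`, `hmarginR` are explicit hypotheses (above).  (2) The format hypothesis
`emin + 3p ≤ 3e₀` (one `p` more than stage B) keeps `o3derrboundC ⊗ permanent` out of the
subnormal range; for binary64 (`p = 53`, `emin = −1074`) it reads `e₀ ≥ −305`, i.e. coordinates
that are multiples of `2^−305` — the theorem says nothing about smaller (subnormal-scale) inputs,
nor about overflow (the model has no `+∞`).  (3) The returned VALUE `d` is only claimed to have the
correct sign (Shewchuk: stage C's `det` is an approximation good to `O(ε²)`; we do not formalise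
that).  (4) Stage D (the exact 192-component finish) is not modelled here.

References: J. R. Shewchuk, Discrete Comput. Geom. 18 (1997) 305–363, §4.3, Fig. 21–22, Table 3;
`predicates.c` (public domain), routine `orient3dadapt` [Shewchuk1997].
-/

namespace Summit.Ventures.CertifiedArithmetic.Expansions

open Literature.ComputerArithmetic.JeannerodRump2018
open Literature.ComputerArithmetic.BoldoJeannerodMelquiondMuller2023 hiding twoSum twoSum_fst
  isFloat_twoSum
open Literature.ComputerArithmetic.Shewchuk1997

variable {p : ℕ} {emin : ℤ} {fl : ℚ → ℚ}

/-! ## The stage-C test is sound -/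

/-- **THE STAGE-C TEST OF `orient3dadapt` IS SOUND — generic in the `estimate` bound `δ` and the
coefficient `K_R`** (`p ≥ 4`, `fl` a `RoundoffBelow 2` round-to-nearest into `F(p, emin)`,
`0 ≤ δ < 1` with `hest`, `K_R ∈ 2^(−2p) ℤ` with the margin `δ < (1 − δ)(1 − ε)³ K_R` (`hmarginR`),
coordinates in `F(p, e₀)`, `emin ≤ e₀`, `emin + 3p ≤ 3e₀`, two-product exact on the formats used):
if stage C, run with `K_C = o3derrboundC p`, `K_R` and stage A's permanent, returns `d`, then
`d > 0 ↔ (7) > 0` and `d < 0 ↔ (7) < 0` for the exact `orient3dDet`; in particular `d ≠ 0`. -/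
theorem orient3dStageC_correct_of_estimate_of_margin (hp : 4 ≤ p)
    (hfl : IsRoundNearest p emin fl) (hfl2 : RoundoffBelow 2 fl) {δ KR : ℚ} (hδ0 : 0 ≤ δ)
    (hδ1 : δ < 1) (hKR : OnGrid (-(2 * (p : ℤ))) KR)
    (hmarginR : δ < (1 - δ) * ((1 - unitRoundoff p) ^ 3 * KR))
    (hest : ∀ ⦃l : List ℚ⦄, (∀ x ∈ l, IsFloat p emin x) → IsWeakExpansion l →
      |estimate fl l - l.sum| ≤ δ * |l.sum|)
    {e₀ : ℤ} (he₀ : emin ≤ e₀) (h3p : emin + 3 * p ≤ e₀ + e₀ + e₀)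
    {a₁ a₂ a₃ b₁ b₂ b₃ c₁ c₂ c₃ d₁ d₂ d₃ : ℚ}
    (ha₁ : IsFloat p e₀ a₁) (ha₂ : IsFloat p e₀ a₂) (ha₃ : IsFloat p e₀ a₃)
    (hb₁ : IsFloat p e₀ b₁) (hb₂ : IsFloat p e₀ b₂) (hb₃ : IsFloat p e₀ b₃)
    (hc₁ : IsFloat p e₀ c₁) (hc₂ : IsFloat p e₀ c₂) (hc₃ : IsFloat p e₀ c₃)
    (hd₁ : IsFloat p e₀ d₁) (hd₂ : IsFloat p e₀ d₂) (hd₃ : IsFloat p e₀ d₃)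
    {tp : ℚ → ℚ → ℚ × ℚ}
    (htp : ∀ x y, IsFloat p e₀ x → IsFloat p e₀ y → ExactTwoProd p emin fl tp x y)
    (htp' : ∀ x y, IsFloat p (e₀ + e₀) x → IsFloat p e₀ y → ExactTwoProd p emin fl tp x y)
    {d : ℚ}
    (hC : orient3dStageC tp fl (o3derrboundC p) KR
      (orient3dPermanent fl a₁ a₂ a₃ b₁ b₂ b₃ c₁ c₂ c₃ d₁ d₂ d₃)
      a₁ a₂ a₃ b₁ b₂ b₃ c₁ c₂ c₃ d₁ d₂ d₃ = some d) :
    (0 < d ↔ 0 < orient3dDet a₁ a₂ a₃ b₁ b₂ b₃ c₁ c₂ c₃ d₁ d₂ d₃) ∧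
      (d < 0 ↔ orient3dDet a₁ a₂ a₃ b₁ b₂ b₃ c₁ c₂ c₃ d₁ d₂ d₃ < 0) := by
  have hp1 : 1 ≤ p := le_trans (by norm_num) hp
  have he₂ : emin ≤ e₀ + e₀ := by omega
  have he₃ : emin ≤ e₀ + e₀ + e₀ := by omega
  have he₃' : emin ≤ e₀ + (e₀ + e₀) := by omega
  have he₄ : emin ≤ -(2 * (p : ℤ)) + (e₀ + e₀ + e₀) := by omega
  have he₅ : emin ≤ -(3 * (p : ℤ)) + (e₀ + e₀ + e₀) := by omega
  have hu0 : 0 < unitRoundoff p := by unfold unitRoundoff; positivity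
  have hu16 : unitRoundoff p ≤ 1 / 16 :=
    Literature.ComputerArithmetic.BoldoMuller2011.unitRoundoff_le_sixteenth hp
  have hu2 : unitRoundoff p ≤ 1 / 2 := by linarith
  have hmarginC := o3derrboundC_margin hp
  -- grids: the nine differences (`2^e₀ ℤ`), their roundings (floats of `F(p, e₀)`), their tails
  have gta₁ := (OnGrid.of_isFloat ha₁).sub (OnGrid.of_isFloat hd₁)
  have gta₂ := (OnGrid.of_isFloat ha₂).sub (OnGrid.of_isFloat hd₂)
  have gta₃ := (OnGrid.of_isFloat ha₃).sub (OnGrid.of_isFloat hd₃)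
  have gtb₁ := (OnGrid.of_isFloat hb₁).sub (OnGrid.of_isFloat hd₁)
  have gtb₂ := (OnGrid.of_isFloat hb₂).sub (OnGrid.of_isFloat hd₂)
  have gtb₃ := (OnGrid.of_isFloat hb₃).sub (OnGrid.of_isFloat hd₃)
  have gtc₁ := (OnGrid.of_isFloat hc₁).sub (OnGrid.of_isFloat hd₁)
  have gtc₂ := (OnGrid.of_isFloat hc₂).sub (OnGrid.of_isFloat hd₂)
  have gtc₃ := (OnGrid.of_isFloat hc₃).sub (OnGrid.of_isFloat hd₃)
  have gxa₁ := gta₁.fl_of hp1 hfl he₀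
  have gxa₂ := gta₂.fl_of hp1 hfl he₀
  have gxa₃ := gta₃.fl_of hp1 hfl he₀
  have gxb₁ := gtb₁.fl_of hp1 hfl he₀
  have gxb₂ := gtb₂.fl_of hp1 hfl he₀
  have gxb₃ := gtb₃.fl_of hp1 hfl he₀
  have gxc₁ := gtc₁.fl_of hp1 hfl he₀
  have gxc₂ := gtc₂.fl_of hp1 hfl he₀
  have gxc₃ := gtc₃.fl_of hp1 hfl he₀
  have fxa₁ : IsFloat p e₀ (fl (a₁ - d₁)) := isFloat_of_isFloat_of_onGrid (hfl _).1 gxa₁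
  have fxa₂ : IsFloat p e₀ (fl (a₂ - d₂)) := isFloat_of_isFloat_of_onGrid (hfl _).1 gxa₂
  have fxa₃ : IsFloat p e₀ (fl (a₃ - d₃)) := isFloat_of_isFloat_of_onGrid (hfl _).1 gxa₃
  have fxb₁ : IsFloat p e₀ (fl (b₁ - d₁)) := isFloat_of_isFloat_of_onGrid (hfl _).1 gxb₁
  have fxb₂ : IsFloat p e₀ (fl (b₂ - d₂)) := isFloat_of_isFloat_of_onGrid (hfl _).1 gxb₂
  have fxb₃ : IsFloat p e₀ (fl (b₃ - d₃)) := isFloat_of_isFloat_of_onGrid (hfl _).1 gxb₃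
  have fxc₁ : IsFloat p e₀ (fl (c₁ - d₁)) := isFloat_of_isFloat_of_onGrid (hfl _).1 gxc₁
  have fxc₂ : IsFloat p e₀ (fl (c₂ - d₂)) := isFloat_of_isFloat_of_onGrid (hfl _).1 gxc₂
  have fxc₃ : IsFloat p e₀ (fl (c₃ - d₃)) := isFloat_of_isFloat_of_onGrid (hfl _).1 gxc₃
  have gτa₁ := gta₁.sub gxa₁
  have gτa₂ := gta₂.sub gxa₂
  have gτa₃ := gta₃.sub gxa₃
  have gτb₁ := gtb₁.sub gxb₁
  have gτb₂ := gtb₂.sub gxb₂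
  have gτb₃ := gtb₃.sub gxb₃
  have gτc₁ := gtc₁.sub gxc₁
  have gτc₂ := gtc₂.sub gxc₂
  have gτc₃ := gtc₃.sub gxc₃
  -- the six products of stage A and their roundings (`2^2e₀ ℤ`)
  have gp₁ := gxb₁.mul gxc₂
  have gp₂ := gxc₁.mul gxb₂
  have gp₃ := gxc₁.mul gxa₂
  have gp₄ := gxa₁.mul gxc₂
  have gp₅ := gxa₁.mul gxb₂
  have gp₆ := gxb₁.mul gxa₂
  have gP₁ := gp₁.fl_of hp1 hfl he₂
  have gP₂ := gp₂.fl_of hp1 hfl he₂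
  have gP₃ := gp₃.fl_of hp1 hfl he₂
  have gP₄ := gp₄.fl_of hp1 hfl he₂
  have gP₅ := gp₅.fl_of hp1 hfl he₂
  have gP₆ := gp₆.fl_of hp1 hfl he₂
  -- term a: products `2^2e₀ ℤ`, sums, the two scalings by `adz`, `adztail` (`2^3e₀ ℤ`)
  have gqa₁ := gxb₁.mul gτc₂
  have gqa₂ := gxc₂.mul gτb₁
  have gqa₃ := gxb₂.mul gτc₁
  have gqa₄ := gxc₁.mul gτb₂
  have gfa₁ := gqa₁.fl_of hp1 hfl he₂
  have gfa₂ := gqa₂.fl_of hp1 hfl he₂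
  have gfa₃ := gqa₃.fl_of hp1 hfl he₂
  have gfa₄ := gqa₄.fl_of hp1 hfl he₂
  have gsa₁ := gfa₁.add gfa₂
  have gsa₂ := gfa₃.add gfa₄
  have gSa₁ := gsa₁.fl_of hp1 hfl he₂
  have gSa₂ := gsa₂.fl_of hp1 hfl he₂
  have gra := gSa₁.sub gSa₂
  have gRa := gra.fl_of hp1 hfl he₂
  have gma := gxa₃.mul gRa
  have gMa := gma.fl_of hp1 hfl he₃'
  have gea := gP₁.sub gP₂
  have gEa := gea.fl_of hp1 hfl he₂
  have gna := gτa₃.mul gEa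
  have gNa := gna.fl_of hp1 hfl he₃'
  have gua := gMa.add gNa
  have gTa := gua.fl_of hp1 hfl he₃'
  -- term b
  have gqb₁ := gxc₁.mul gτa₂
  have gqb₂ := gxa₂.mul gτc₁
  have gqb₃ := gxc₂.mul gτa₁
  have gqb₄ := gxa₁.mul gτc₂
  have gfb₁ := gqb₁.fl_of hp1 hfl he₂
  have gfb₂ := gqb₂.fl_of hp1 hfl he₂
  have gfb₃ := gqb₃.fl_of hp1 hfl he₂
  have gfb₄ := gqb₄.fl_of hp1 hfl he₂
  have gsb₁ := gfb₁.add gfb₂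
  have gsb₂ := gfb₃.add gfb₄
  have gSb₁ := gsb₁.fl_of hp1 hfl he₂
  have gSb₂ := gsb₂.fl_of hp1 hfl he₂
  have grb := gSb₁.sub gSb₂
  have gRb := grb.fl_of hp1 hfl he₂
  have gmb := gxb₃.mul gRb
  have gMb := gmb.fl_of hp1 hfl he₃'
  have geb := gP₃.sub gP₄
  have gEb := geb.fl_of hp1 hfl he₂
  have gnb := gτb₃.mul gEb
  have gNb := gnb.fl_of hp1 hfl he₃'
  have gub := gMb.add gNb
  have gTb := gub.fl_of hp1 hfl he₃'
  -- term c
  have gqc₁ := gxa₁.mul gτb₂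
  have gqc₂ := gxb₂.mul gτa₁
  have gqc₃ := gxa₂.mul gτb₁
  have gqc₄ := gxb₁.mul gτa₂
  have gfc₁ := gqc₁.fl_of hp1 hfl he₂
  have gfc₂ := gqc₂.fl_of hp1 hfl he₂
  have gfc₃ := gqc₃.fl_of hp1 hfl he₂
  have gfc₄ := gqc₄.fl_of hp1 hfl he₂
  have gsc₁ := gfc₁.add gfc₂
  have gsc₂ := gfc₃.add gfc₄
  have gSc₁ := gsc₁.fl_of hp1 hfl he₂
  have gSc₂ := gsc₂.fl_of hp1 hfl he₂
  have grc := gSc₁.sub gSc₂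
  have gRc := grc.fl_of hp1 hfl he₂
  have gmc := gxc₃.mul gRc
  have gMc := gmc.fl_of hp1 hfl he₃'
  have gec := gP₅.sub gP₆
  have gEc := gec.fl_of hp1 hfl he₂
  have gnc := gτc₃.mul gEc
  have gNc := gnc.fl_of hp1 hfl he₃'
  have guc := gMc.add gNc
  have gTc := guc.fl_of hp1 hfl he₃'
  -- the sum of the three terms (`2^3e₀ ℤ`)
  have gv₁ := gTa.add gTb
  have gV₁ := gv₁.fl_of hp1 hfl he₃'
  have gv := gV₁.add gTc
  have gV := gv.fl_of hp1 hfl he₃'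
  -- the permanent chain (as in stage B): `A_a = fl(|P₁| + |P₂|)`, `α_a = fl(A_a |adz|)`, `W₁`, `W`
  have gAsa := gP₁.abs.add gP₂.abs
  have gAsb := gP₃.abs.add gP₄.abs
  have gAsc := gP₅.abs.add gP₆.abs
  have gAa := gAsa.fl_of hp1 hfl he₂
  have gAb := gAsb.fl_of hp1 hfl he₂
  have gAc := gAsc.fl_of hp1 hfl he₂
  have gala := gAa.mul gxa₃.abs
  have galb := gAb.mul gxb₃.abs
  have galc := gAc.mul gxc₃.abs
  have gαa := gala.fl_of hp1 hfl he₃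
  have gαb := galb.fl_of hp1 hfl he₃
  have gαc := galc.fl_of hp1 hfl he₃
  have gw₁ := gαa.add gαb
  have gW₁ := gw₁.fl_of hp1 hfl he₃
  have gw := gW₁.add gαc
  have gW := gw.fl_of hp1 hfl he₃
  -- `det = estimate(fin1)` on `2^3e₀ ℤ`, `det' = det ⊕ c`, the error bound on `2^(3e₀ − 3p) ℤ`
  have gdB : OnGrid (e₀ + e₀ + e₀) (estimate fl (orient3dB tp fl (fl (a₁ - d₁)) (fl (a₂ - d₂))
      (fl (a₃ - d₃)) (fl (b₁ - d₁)) (fl (b₂ - d₂)) (fl (b₃ - d₃)) (fl (c₁ - d₁)) (fl (c₂ - d₂))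
      (fl (c₃ - d₃)))) :=
    onGrid_estimate hp1 hfl he₃ (orient3dB_onGrid hp hfl hfl2 he₂ he₃ htp htp' fxa₁ fxa₂ fxa₃
      fxb₁ fxb₂ fxb₃ fxc₁ fxc₂ fxc₃)
  have gdc := gdB.add (gV.mono (by omega))
  have hdC := abs_sub_fl_le_eps_mul_abs_fl hp1 hfl he₃ gdc
  rw [abs_sub_comm] at hdC
  have gKW := (onGrid_o3derrboundC p).mul gW
  have gKd := hKR.mul gdB.abs
  have gE₁ := gKW.fl_of hp1 hfl he₅
  have gE₂ := (gKd.fl_of hp1 hfl he₄).mono (show -(3 * (p : ℤ)) + (e₀ + e₀ + e₀)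
    ≤ -(2 * (p : ℤ)) + (e₀ + e₀ + e₀) by omega)
  have gE := gE₁.add gE₂
  -- `fin1` is a W-expansion of floats with sum `B`; `det = estimate fin1 = B ± δB`
  obtain ⟨hW, hS, hF, -, -, -⟩ :=
    orient3dB_spec hp hfl hfl2 he₂ he₃ htp htp' fxa₁ fxa₂ fxa₃ fxb₁ fxb₂ fxb₃ fxc₁ fxc₂ fxc₃
  have hest := hest hF hW
  rw [hS] at hest
  unfold orient3dDetB at hest
  -- stage C returned: the test passed and `d = det'`
  unfold orient3dStageC at hC
  simp only [] at hC
  split_ifs at hC with htest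
  obtain rfl := Option.some.inj hC
  simp only [orient3dPermanent] at htest
  have key := orient3d_stageC_sign_of_bounds hu0 hu2 hδ0 hδ1 hmarginC hmarginR
    (abs_sub_fl_le_eps_mul_abs_fl hp1 hfl he₀ gta₁) (abs_sub_fl_le_eps_mul_abs_fl hp1 hfl he₀ gta₂)
    (abs_sub_fl_le_eps_mul_abs_fl hp1 hfl he₀ gta₃) (abs_sub_fl_le_eps_mul_abs_fl hp1 hfl he₀ gtb₁)
    (abs_sub_fl_le_eps_mul_abs_fl hp1 hfl he₀ gtb₂) (abs_sub_fl_le_eps_mul_abs_fl hp1 hfl he₀ gtb₃)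
    (abs_sub_fl_le_eps_mul_abs_fl hp1 hfl he₀ gtc₁) (abs_sub_fl_le_eps_mul_abs_fl hp1 hfl he₀ gtc₂)
    (abs_sub_fl_le_eps_mul_abs_fl hp1 hfl he₀ gtc₃)
    (abs_sub_fl_le_eps_mul_abs_fl hp1 hfl he₂ gp₁) (abs_sub_fl_le_eps_mul_abs_fl hp1 hfl he₂ gp₂)
    (abs_sub_fl_le_eps_mul_abs_fl hp1 hfl he₂ gp₃) (abs_sub_fl_le_eps_mul_abs_fl hp1 hfl he₂ gp₄)
    (abs_sub_fl_le_eps_mul_abs_fl hp1 hfl he₂ gp₅) (abs_sub_fl_le_eps_mul_abs_fl hp1 hfl he₂ gp₆)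
    -- term a
    (abs_sub_fl_le_eps_mul_abs hp1 hfl he₂ gqa₁) (abs_sub_fl_le_eps_mul_abs hp1 hfl he₂ gqa₂)
    (abs_sub_fl_le_eps_mul_abs hp1 hfl he₂ gqa₃) (abs_sub_fl_le_eps_mul_abs hp1 hfl he₂ gqa₄)
    (abs_sub_fl_le_eps_mul_abs hp1 hfl he₂ gsa₁) (abs_sub_fl_le_eps_mul_abs hp1 hfl he₂ gsa₂)
    (abs_sub_fl_le_eps_mul_abs hp1 hfl he₂ gra) (abs_sub_fl_le_eps_mul_abs hp1 hfl he₃' gma)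
    (abs_sub_fl_le_eps_mul_abs hp1 hfl he₂ gea) (abs_sub_fl_le_eps_mul_abs hp1 hfl he₃' gna)
    (abs_sub_fl_le_eps_mul_abs hp1 hfl he₃' gua)
    -- term b
    (abs_sub_fl_le_eps_mul_abs hp1 hfl he₂ gqb₁) (abs_sub_fl_le_eps_mul_abs hp1 hfl he₂ gqb₂)
    (abs_sub_fl_le_eps_mul_abs hp1 hfl he₂ gqb₃) (abs_sub_fl_le_eps_mul_abs hp1 hfl he₂ gqb₄)
    (abs_sub_fl_le_eps_mul_abs hp1 hfl he₂ gsb₁) (abs_sub_fl_le_eps_mul_abs hp1 hfl he₂ gsb₂)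
    (abs_sub_fl_le_eps_mul_abs hp1 hfl he₂ grb) (abs_sub_fl_le_eps_mul_abs hp1 hfl he₃' gmb)
    (abs_sub_fl_le_eps_mul_abs hp1 hfl he₂ geb) (abs_sub_fl_le_eps_mul_abs hp1 hfl he₃' gnb)
    (abs_sub_fl_le_eps_mul_abs hp1 hfl he₃' gub)
    -- term c
    (abs_sub_fl_le_eps_mul_abs hp1 hfl he₂ gqc₁) (abs_sub_fl_le_eps_mul_abs hp1 hfl he₂ gqc₂)
    (abs_sub_fl_le_eps_mul_abs hp1 hfl he₂ gqc₃) (abs_sub_fl_le_eps_mul_abs hp1 hfl he₂ gqc₄)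
    (abs_sub_fl_le_eps_mul_abs hp1 hfl he₂ gsc₁) (abs_sub_fl_le_eps_mul_abs hp1 hfl he₂ gsc₂)
    (abs_sub_fl_le_eps_mul_abs hp1 hfl he₂ grc) (abs_sub_fl_le_eps_mul_abs hp1 hfl he₃' gmc)
    (abs_sub_fl_le_eps_mul_abs hp1 hfl he₂ gec) (abs_sub_fl_le_eps_mul_abs hp1 hfl he₃' gnc)
    (abs_sub_fl_le_eps_mul_abs hp1 hfl he₃' guc)
    -- the sum, the permanent, the estimate, `det'`, the error bound, the test
    (abs_sub_fl_le_eps_mul_abs hp1 hfl he₃' gv₁) (abs_sub_fl_le_eps_mul_abs hp1 hfl he₃' gv)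
    (abs_sub_fl_le_eps_mul_abs hp1 hfl he₂ gAsa) (abs_sub_fl_le_eps_mul_abs hp1 hfl he₂ gAsb)
    (abs_sub_fl_le_eps_mul_abs hp1 hfl he₂ gAsc)
    (abs_sub_fl_le_eps_mul_abs hp1 hfl he₃ gala) (abs_sub_fl_le_eps_mul_abs hp1 hfl he₃ galb)
    (abs_sub_fl_le_eps_mul_abs hp1 hfl he₃ galc)
    (abs_sub_fl_le_eps_mul_abs hp1 hfl he₃ gw₁) (abs_sub_fl_le_eps_mul_abs hp1 hfl he₃ gw)
    hest hdC (abs_sub_fl_le_eps_mul_abs hp1 hfl he₅ gKW) (abs_sub_fl_le_eps_mul_abs hp1 hfl he₄ gKd)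
    (abs_sub_fl_le_eps_mul_abs hp1 hfl he₅ gE)
    (htest.elim (fun h => le_trans h (le_abs_self _)) (fun h => le_trans h (neg_le_abs _)))
  have hT : orient3dDet a₁ a₂ a₃ b₁ b₂ b₃ c₁ c₂ c₃ d₁ d₂ d₃
      = (fl (a₃ - d₃) + (a₃ - d₃ - fl (a₃ - d₃)))
          * ((fl (b₁ - d₁) + (b₁ - d₁ - fl (b₁ - d₁))) * (fl (c₂ - d₂) + (c₂ - d₂ - fl (c₂ - d₂)))
            - (fl (c₁ - d₁) + (c₁ - d₁ - fl (c₁ - d₁))) * (fl (b₂ - d₂) + (b₂ - d₂ - fl (b₂ - d₂))))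
        + (fl (b₃ - d₃) + (b₃ - d₃ - fl (b₃ - d₃)))
          * ((fl (c₁ - d₁) + (c₁ - d₁ - fl (c₁ - d₁))) * (fl (a₂ - d₂) + (a₂ - d₂ - fl (a₂ - d₂)))
            - (fl (a₁ - d₁) + (a₁ - d₁ - fl (a₁ - d₁))) * (fl (c₂ - d₂) + (c₂ - d₂ - fl (c₂ - d₂))))
        + (fl (c₃ - d₃) + (c₃ - d₃ - fl (c₃ - d₃)))
          * ((fl (a₁ - d₁) + (a₁ - d₁ - fl (a₁ - d₁))) * (fl (b₂ - d₂) + (b₂ - d₂ - fl (b₂ - d₂)))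
            - (fl (b₁ - d₁) + (b₁ - d₁ - fl (b₁ - d₁)))
              * (fl (a₂ - d₂) + (a₂ - d₂ - fl (a₂ - d₂)))) := by
    unfold orient3dDet; ring
  rw [hT]
  exact key

/-- **The lane's instance `δ = 3ε`, `K_R = o3dresulterrbound24 p = (3 + 24ε)ε`**: stage C is sound
given the `3ε` relative error bound of `estimate` on W-expansions of floats (`hest3`, the
conclusion of `EstimateRelativeError`; `p ≥ 4`). -/
theorem orient3dStageC_correct_of_estimate (hp : 4 ≤ p) (hfl : IsRoundNearest p emin fl)
    (hfl2 : RoundoffBelow 2 fl)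
    (hest3 : ∀ ⦃l : List ℚ⦄, (∀ x ∈ l, IsFloat p emin x) → IsWeakExpansion l →
      |estimate fl l - l.sum| ≤ 3 * unitRoundoff p * |l.sum|)
    {e₀ : ℤ} (he₀ : emin ≤ e₀) (h3p : emin + 3 * p ≤ e₀ + e₀ + e₀)
    {a₁ a₂ a₃ b₁ b₂ b₃ c₁ c₂ c₃ d₁ d₂ d₃ : ℚ}
    (ha₁ : IsFloat p e₀ a₁) (ha₂ : IsFloat p e₀ a₂) (ha₃ : IsFloat p e₀ a₃)
    (hb₁ : IsFloat p e₀ b₁) (hb₂ : IsFloat p e₀ b₂) (hb₃ : IsFloat p e₀ b₃)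
    (hc₁ : IsFloat p e₀ c₁) (hc₂ : IsFloat p e₀ c₂) (hc₃ : IsFloat p e₀ c₃)
    (hd₁ : IsFloat p e₀ d₁) (hd₂ : IsFloat p e₀ d₂) (hd₃ : IsFloat p e₀ d₃)
    {tp : ℚ → ℚ → ℚ × ℚ}
    (htp : ∀ x y, IsFloat p e₀ x → IsFloat p e₀ y → ExactTwoProd p emin fl tp x y)
    (htp' : ∀ x y, IsFloat p (e₀ + e₀) x → IsFloat p e₀ y → ExactTwoProd p emin fl tp x y)
    {d : ℚ}
    (hC : orient3dStageC tp fl (o3derrboundC p) (o3dresulterrbound24 p)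
      (orient3dPermanent fl a₁ a₂ a₃ b₁ b₂ b₃ c₁ c₂ c₃ d₁ d₂ d₃)
      a₁ a₂ a₃ b₁ b₂ b₃ c₁ c₂ c₃ d₁ d₂ d₃ = some d) :
    (0 < d ↔ 0 < orient3dDet a₁ a₂ a₃ b₁ b₂ b₃ c₁ c₂ c₃ d₁ d₂ d₃) ∧
      (d < 0 ↔ orient3dDet a₁ a₂ a₃ b₁ b₂ b₃ c₁ c₂ c₃ d₁ d₂ d₃ < 0) := by
  have hu0 : 0 < unitRoundoff p := by unfold unitRoundoff; positivity
  have hu16 : unitRoundoff p ≤ 1 / 16 :=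
    Literature.ComputerArithmetic.BoldoMuller2011.unitRoundoff_le_sixteenth hp
  exact orient3dStageC_correct_of_estimate_of_margin hp hfl hfl2 (by positivity) (by linarith)
    (onGrid_o3dresulterrbound24 p) (o3dresulterrbound24_margin hp) hest3 he₀ h3p ha₁ ha₂ ha₃ hb₁
    hb₂ hb₃ hc₁ hc₂ hc₃ hd₁ hd₂ hd₃ htp htp' hC

end Summit.Ventures.CertifiedArithmetic.Expansions
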